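import Summits.KontsevichZagierPeriods.KontsevichZagierPeriods.Theses.LiftingCriteria
import Summits.KontsevichZagierPeriods.KontsevichZagierPeriods.Theorems.LiftingCriteriaDilationLiftAtOneTwistedDiagonal
import Summits.KontsevichZagierPeriods.KontsevichZagierPeriods.Theorems.LiftingCriteriaDilationLiftAtOneBakerSectorComplex
import Summits.KontsevichZagierPeriods.KontsevichZagierPeriods.Theorems.LiftingCriteriaDilationLiftAtOneDimOneRational
import Literature.NumberTheory.Transcendental.KZDilationStokesDescentDimTwo
import Literature.NumberTheory.Transcendental.KZDilationStokesSwap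

/-!
# `DilationLiftAtOne` holds for all two-variable `x₀`-exact rational KZ data (crux
stmt-KontsevichZagierPeriods-3571, route LiftingCriteria, line `registered`, registered stub
`stub_dimTwoStokesRational`)

**Theorem (unconditional, `dilationLiftAtOne_dimTwoStokesRational`).** Let
`h_i = ∂₀(P_i/Q_i)` (`i < S`) with `P_i, Q_i ∈ ℚ[x₀,x₁]`, `Q_i` non-vanishing on the open box
`(a,b)² ⊇ [0,1]²` (rational `a < 0 < 1 < b`) — Nash cube functions of TWO variables
(`dimTwoStokes_isCubeNashData`) — and `m_i, m₀ ∈ ℤ` with `m₀ + Σ m_i ∫_{[0,1]²} h_i = 0`. Then the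
dilation G-function `m₀ + Σ m_i ∫_{[0,1]²} h_i(ϖz) dz` factors on `[0,1]` as
`(ϖ − 1)·(v_{G₀}(ϖ) + Σ m_i v_{G_i}(ϖ))` with Nash cube functions `G₀, G_i` of two variables — the
conclusion of the crux `DilationLiftAtOne` for these data. Chain: (S3⁗) `stub_dimTwoStokesRational`
— the Stokes move lifts through the dilation pencil: `v_{h_i} = v_{k_i} + (ϖ − 1)∫₀¹ K_i(ϖ, ϖy) dy`
with ONE-variable rational `k_i(u) = B_i(1,u) − B_i(0,u)` and a rational Nash kernel `K_i` (exact
polynomial division `N = t(t − 1)N₁`, Literature `KZ.StokesDescent.*`); (S3‴) `stub_dimOneRational` +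
(S3″) `stub_bakerSectorComplex` (Baker's theorem) lift the one-variable part; (S4)
`stub_twistedDiagonal` turns each kernel into a dilation function. This is the first
two-dimensional sector of the crux and the kernel-checked Stokes sector of its functional half
("moves lift"); it contains every one-variable rational datum `g(x₁)` as `h = ∂₀(x₀ g(x₁))`.
-/

noncomputable section

open scoped BigOperators

namespace Summit.KontsevichZagierPeriods.LiftingCriteria.DilationLiftAtOne

/-- **Stub `stub_dimTwoStokesRational` of the registered skeleton of crux
stmt-KontsevichZagierPeriods-3571 (line `registered`, reshape 4 by lead c2): Stokes descent for
two-variable `x₀`-exact rational data.** Verbatim the registered signature; proof: `choose` over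
`Literature.NumberTheory.Transcendental.KZ.StokesDescent.exists_stokes_repr_dimTwo`, `V = (a,b)²`.
[cite: KontsevichZagier2001, §1.2] -/
theorem stub_dimTwoStokesRational :
    ∀ (S : ℕ) (P Q : Fin S → MvPolynomial (Fin 2) ℚ) (a b : ℚ), (a:ℝ) < 0 → 1 < (b:ℝ) → (∀ i, ∀ p ∈ Set.pi Set.univ (fun _ : Fin 2 => Set.Ioo (a:ℝ) b), MvPolynomial.aeval p (Q i) ≠ 0) → ∃ (Kn Kd : Fin S → Polynomial ℚ) (K : Fin S → (Fin 2 → ℝ) → ℝ) (V : Set (Fin 2 → ℝ)), (∀ i, ∀ x ∈ Set.Ioo (a:ℝ) b, Polynomial.aeval x (Kd i) ≠ 0) ∧ IsOpen V ∧ (∀ ϖ ∈ Set.Icc (0:ℝ) 1, ∀ x ∈ Set.pi Set.univ (fun _ : Fin 1 => Set.Icc (0:ℝ) 1), Matrix.vecCons ϖ x ∈ V) ∧ (∀ i, Literature.NumberTheory.Transcendental.IsSemialgebraicFunOn ℚ V (K i)) ∧ (∀ i, AnalyticOnNhd ℝ (K i) V) ∧ ∀ i, ∀ ϖ ∈ Set.Icc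 (0:ℝ) 1, (∫ z in Set.pi Set.univ (fun _ : Fin 2 => Set.Icc (0:ℝ) 1), (MvPolynomial.aeval (ϖ • z) (MvPolynomial.pderiv 0 (P i)) * MvPolynomial.aeval (ϖ • z) (Q i) - MvPolynomial.aeval (ϖ • z) (P i) * MvPolynomial.aeval (ϖ • z) (MvPolynomial.pderiv 0 (Q i))) / (MvPolynomial.aeval (ϖ • z) (Q i)) ^ 2) = (∫ z in Set.pi Set.univ (fun _ : Fin 1 => Set.Icc (0:ℝ) 1), Polynomial.aeval ((ϖ • z) 0) (Kn i) / Polynomial.aeval ((ϖ • z) 0) (Kd i)) + (ϖ - 1) * ∫ y in Set.pi Set.univ (fun _ : Fin 1 => Set.Icc (0:ℝ) 1), K i (Matrix.vecCons ϖ (ϖ • y)) := by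
  intro S P Q a b ha hb hQ
  have hex := fun i =>
    Literature.NumberTheory.Transcendental.KZ.StokesDescent.exists_stokes_repr_dimTwo ha hb (P i) (Q i)
      (hQ i)
  choose Kn Kd K hKd hKs hKa hid using hex
  refine ⟨Kn, Kd, K, Set.pi Set.univ (fun _ : Fin 2 => Set.Ioo (a:ℝ) b), hKd,
    Literature.NumberTheory.Transcendental.KZ.StokesDescent.isOpen_box 2 (a:ℝ) b,
    fun ϖ hϖ x hx =>
      Literature.NumberTheory.Transcendental.KZ.StokesDescent.vecCons_mem_box ha hb hϖ hx,
    hKs, hKa, hid⟩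

/-- The data of the sector ARE Nash cube data of the crux: `h_i = ∂₀(P_i/Q_i)` is
`ℚ`-semialgebraic and real-analytic on the open box `(a,b)² ⊇ [0,1]²`.
[cite: BochnakCosteRoy1998, §2.2] -/
theorem dimTwoStokes_isCubeNashData (P Q : MvPolynomial (Fin 2) ℚ) (a b : ℚ)
    (ha : (a:ℝ) < 0) (hb : 1 < (b:ℝ))
    (hQ : ∀ p ∈ Set.pi Set.univ (fun _ : Fin 2 => Set.Ioo (a:ℝ) b), MvPolynomial.aeval p Q ≠ 0) :
    IsOpen (Set.pi Set.univ (fun _ : Fin 2 => Set.Ioo (a:ℝ) b)) ∧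
      Set.pi Set.univ (fun _ : Fin 2 => Set.Icc (0:ℝ) 1) ⊆
        Set.pi Set.univ (fun _ : Fin 2 => Set.Ioo (a:ℝ) b) ∧
      Literature.NumberTheory.Transcendental.IsSemialgebraicFunOn ℚ
        (Set.pi Set.univ (fun _ : Fin 2 => Set.Ioo (a:ℝ) b))
        (fun p => (MvPolynomial.aeval p (MvPolynomial.pderiv 0 P) * MvPolynomial.aeval p Q -
            MvPolynomial.aeval p P * MvPolynomial.aeval p (MvPolynomial.pderiv 0 Q)) /
          (MvPolynomial.aeval p Q) ^ 2) ∧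
      AnalyticOnNhd ℝ
        (fun p => (MvPolynomial.aeval p (MvPolynomial.pderiv 0 P) * MvPolynomial.aeval p Q -
            MvPolynomial.aeval p P * MvPolynomial.aeval p (MvPolynomial.pderiv 0 Q)) /
          (MvPolynomial.aeval p Q) ^ 2)
        (Set.pi Set.univ (fun _ : Fin 2 => Set.Ioo (a:ℝ) b)) :=
  ⟨Literature.NumberTheory.Transcendental.KZ.StokesDescent.isOpen_box 2 (a:ℝ) b,
    Literature.NumberTheory.Transcendental.KZ.StokesDescent.cube_subset_box ha hb,
    Literature.NumberTheory.Transcendental.KZ.StokesDescent.isSemialgebraicFunOn_pderivQuot a b P Q hQ,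
    Literature.NumberTheory.Transcendental.KZ.StokesDescent.analyticOnNhd_pderivQuot P Q hQ⟩

/-- **`DilationLiftAtOne` for two-variable `x₀`-exact rational data (unconditional).** See the
module docstring. [cite: KontsevichZagier2001, §1.2] -/
theorem dilationLiftAtOne_dimTwoStokesRational (S : ℕ) (P Q : Fin S → MvPolynomial (Fin 2) ℚ)
    (a b : ℚ) (ha : (a:ℝ) < 0) (hb : 1 < (b:ℝ))
    (hQ : ∀ i, ∀ p ∈ Set.pi Set.univ (fun _ : Fin 2 => Set.Ioo (a:ℝ) b),
      MvPolynomial.aeval p (Q i) ≠ 0)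
    (m : Fin S → ℤ) (m₀ : ℤ)
    (hsum : (m₀ : ℝ) + ∑ i, (m i : ℝ) *
      (∫ z in Set.pi Set.univ (fun _ : Fin 2 => Set.Icc (0:ℝ) 1),
        (MvPolynomial.aeval (((1:ℝ)) • z) (MvPolynomial.pderiv 0 (P i)) *
              MvPolynomial.aeval (((1:ℝ)) • z) (Q i) -
            MvPolynomial.aeval (((1:ℝ)) • z) (P i) *
              MvPolynomial.aeval (((1:ℝ)) • z) (MvPolynomial.pderiv 0 (Q i))) /
          (MvPolynomial.aeval (((1:ℝ)) • z) (Q i)) ^ 2) = 0) :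
    ∃ (T : ℕ) (d : Fin T → ℕ) (G : (j : Fin T) → (Fin (d j) → ℝ) → ℝ)
      (V : (j : Fin T) → Set (Fin (d j) → ℝ)) (μ : Fin T → Polynomial ℝ) (μ₀ : Polynomial ℝ),
      (∀ j, IsOpen (V j) ∧ Set.pi Set.univ (fun _ : Fin (d j) => Set.Icc (0:ℝ) 1) ⊆ (V j) ∧
        Literature.NumberTheory.Transcendental.IsSemialgebraicFunOn ℚ (V j) (G j) ∧
        AnalyticOnNhd ℝ (G j) (V j)) ∧
      (∀ j k, IsAlgebraic ℚ ((μ j).coeff k)) ∧ (∀ k, IsAlgebraic ℚ (μ₀.coeff k)) ∧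
      ∀ ϖ ∈ Set.Icc (0:ℝ) 1, (m₀ : ℝ) + ∑ i, (m i : ℝ) *
          (∫ z in Set.pi Set.univ (fun _ : Fin 2 => Set.Icc (0:ℝ) 1),
            (MvPolynomial.aeval (ϖ • z) (MvPolynomial.pderiv 0 (P i)) *
                  MvPolynomial.aeval (ϖ • z) (Q i) -
                MvPolynomial.aeval (ϖ • z) (P i) *
                  MvPolynomial.aeval (ϖ • z) (MvPolynomial.pderiv 0 (Q i))) /
              (MvPolynomial.aeval (ϖ • z) (Q i)) ^ 2) =
        (ϖ - 1) * (μ₀.eval ϖ + ∑ j, (μ j).eval ϖ *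
          (∫ z in Set.pi Set.univ (fun _ : Fin (d j) => Set.Icc (0:ℝ) 1), G j (ϖ • z))) := by
  classical
  have h1I : (1:ℝ) ∈ Set.Icc (0:ℝ) 1 := ⟨zero_le_one, le_rfl⟩
  -- (S3⁗) Stokes descent: one-variable data + kernels
  obtain ⟨Kn, Kd, K, V, hKd, hVo, hVc, hKs, hKa, hid⟩ := stub_dimTwoStokesRational S P Q a b ha hb hQ
  -- (S3‴) the one-variable rational data are complex Baker-sector data
  obtain ⟨ρ, A, p, q, γ, δ, hρs, hρa, hp, hq, hγ, hδ, hslit, hrepr⟩ :=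
    stub_dimOneRational S Kn Kd a b ha hb hKd m m₀
  have hk1 : ∀ i, (∫ z in Set.pi Set.univ (fun _ : Fin 1 => Set.Icc (0:ℝ) 1),
      Polynomial.aeval (((1:ℝ) • z) 0) (Kn i) / Polynomial.aeval (((1:ℝ) • z) 0) (Kd i)) =
      ∫ z in Set.pi Set.univ (fun _ : Fin 2 => Set.Icc (0:ℝ) 1),
        (MvPolynomial.aeval ((1:ℝ) • z) (MvPolynomial.pderiv 0 (P i)) *
              MvPolynomial.aeval ((1:ℝ) • z) (Q i) -
            MvPolynomial.aeval ((1:ℝ) • z) (P i) *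
              MvPolynomial.aeval ((1:ℝ) • z) (MvPolynomial.pderiv 0 (Q i))) /
          (MvPolynomial.aeval ((1:ℝ) • z) (Q i)) ^ 2 := by
    intro i
    rw [hid i 1 h1I]
    ring
  have h1 : (∫ z in Set.pi Set.univ (fun _ : Fin 1 => Set.Icc (0:ℝ) 1),
      (deriv ρ (((1:ℝ) • z) 0) + ∑ k, (γ k * (-p k + (p k ^ 2 + q k ^ 2) * (((1:ℝ) • z) 0)) +
        δ k * q k) / ((1 - p k * (((1:ℝ) • z) 0)) ^ 2 + (q k * (((1:ℝ) • z) 0)) ^ 2))) = 0 := by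
    rw [← hrepr 1 h1I]
    simp only [hk1]
    exact hsum
  -- (S3″) the complex Baker-sector lift for the one-variable part, one kernel on `[0,1]`
  obtain ⟨K₀, V₀, hV₀o, hV₀c, hK₀s, hK₀a, hid₀⟩ :=
    stub_bakerSectorComplex a b ha hb ρ hρs hρa A p q γ δ hp hq hγ hδ hslit h1
  -- (S4) every twisted-diagonal integral is one dilation function
  obtain ⟨G₀, V₀', hG₀, hG₀K⟩ := stub_twistedDiagonal 1 K₀ V₀ hV₀o hV₀c hK₀s hK₀a
  have hGi : ∀ i, ∃ (G : (Fin (1 + 1) → ℝ) → ℝ) (V' : Set (Fin (1 + 1) → ℝ)),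
      (IsOpen V' ∧ Set.pi Set.univ (fun _ : Fin (1 + 1) => Set.Icc (0:ℝ) 1) ⊆ V' ∧
        Literature.NumberTheory.Transcendental.IsSemialgebraicFunOn ℚ V' G ∧ AnalyticOnNhd ℝ G V') ∧
      ∀ ϖ ∈ Set.Icc (0:ℝ) 1, (∫ y in Set.pi Set.univ (fun _ : Fin 1 => Set.Icc (0:ℝ) 1),
        K i (Matrix.vecCons ϖ (ϖ • y))) =
        ∫ y' in Set.pi Set.univ (fun _ : Fin (1 + 1) => Set.Icc (0:ℝ) 1), G (ϖ • y') :=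
    fun i => stub_twistedDiagonal 1 (K i) V hVo hVc (hKs i) (hKa i)
  choose G V' hG hGK using hGi
  refine ⟨S + 1, fun _ => 1 + 1,
    fun j => Fin.cases (motive := fun _ => (Fin (1 + 1) → ℝ) → ℝ) G₀ G j,
    fun j => Fin.cases (motive := fun _ => Set (Fin (1 + 1) → ℝ)) V₀' V' j,
    fun j => Fin.cases (motive := fun _ => Polynomial ℝ) 1 (fun i => Polynomial.C (m i : ℝ)) j, 0,
    ?_, ?_, ?_, ?_⟩
  · intro j
    refine Fin.cases ?_ (fun i => ?_) j
    · simpa using hG₀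
    · simpa using hG i
  · intro j k
    refine Fin.cases ?_ (fun i => ?_) j
    · simp only [Fin.cases_zero, Polynomial.coeff_one]
      split_ifs
      · exact isAlgebraic_one
      · exact isAlgebraic_zero
    · simp only [Fin.cases_succ, Polynomial.coeff_C]
      split_ifs
      · simpa using isAlgebraic_algebraMap (R := ℚ) (A := ℝ) (m i : ℚ)
      · exact isAlgebraic_zero
  · intro k
    rw [Polynomial.coeff_zero]
    exact isAlgebraic_zero
  · intro ϖ hϖ
    have hsplit : (∑ i, (m i : ℝ) * ∫ z in Set.pi Set.univ (fun _ : Fin 2 => Set.Icc (0:ℝ) 1),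
        (MvPolynomial.aeval (ϖ • z) (MvPolynomial.pderiv 0 (P i)) * MvPolynomial.aeval (ϖ • z) (Q i) -
            MvPolynomial.aeval (ϖ • z) (P i) * MvPolynomial.aeval (ϖ • z) (MvPolynomial.pderiv 0 (Q i))) /
          (MvPolynomial.aeval (ϖ • z) (Q i)) ^ 2) =
        (∑ i, (m i : ℝ) * ∫ z in Set.pi Set.univ (fun _ : Fin 1 => Set.Icc (0:ℝ) 1),
          Polynomial.aeval ((ϖ • z) 0) (Kn i) / Polynomial.aeval ((ϖ • z) 0) (Kd i)) +
        (ϖ - 1) * ∑ i, (m i : ℝ) * ∫ y' in Set.pi Set.univ (fun _ : Fin (1 + 1) => Set.Icc (0:ℝ) 1),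
          G i (ϖ • y') := by
      rw [Finset.mul_sum, ← Finset.sum_add_distrib]
      refine Finset.sum_congr rfl fun i _ => ?_
      rw [hid i ϖ hϖ, hGK i ϖ hϖ]
      ring
    rw [hsplit, ← add_assoc, hrepr ϖ hϖ, hid₀ ϖ hϖ, hG₀K ϖ hϖ, Fin.sum_univ_succ]
    simp only [Fin.cases_zero, Fin.cases_succ, Polynomial.eval_one, Polynomial.eval_C,
      Polynomial.eval_zero, one_mul, zero_add]
    ring

/-- **`DilationLiftAtOne` for divergences of rational vector fields on the square (unconditional).**
For `h_i = ∂_{j_i}(P_i/Q_i)` with directions `j_i ∈ {0,1}`, `P_i, Q_i ∈ ℚ[x₀,x₁]`, `Q_i` non-vanishing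
on `(a,b)² ⊇ [0,1]²`, and an integer relation `m₀ + Σ m_i ∫_{[0,1]²} h_i = 0`, the conclusion of the
crux holds: `m₀ + Σ m_i v_{h_i} ∈ (ϖ − 1)·D` on `[0,1]` with Nash cube functions of two variables.
In particular every divergence `∂₀(P₀/Q₀) + ∂₁(P₁/Q₁)` of a rational vector field regular near the
square is covered (list both pieces with the same coefficient). Reduction to the `x₀`-exact case by
the coordinate swap (`KZ.StokesDescent.dilation_integral_pderiv_one_eq_swap`).
[cite: KontsevichZagier2001, §1.2] -/
theorem dilationLiftAtOne_dimTwoDivergenceRational (S : ℕ) (j : Fin S → Fin 2)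
    (P Q : Fin S → MvPolynomial (Fin 2) ℚ) (a b : ℚ) (ha : (a:ℝ) < 0) (hb : 1 < (b:ℝ))
    (hQ : ∀ i, ∀ p ∈ Set.pi Set.univ (fun _ : Fin 2 => Set.Ioo (a:ℝ) b),
      MvPolynomial.aeval p (Q i) ≠ 0)
    (m : Fin S → ℤ) (m₀ : ℤ)
    (hsum : (m₀ : ℝ) + ∑ i, (m i : ℝ) *
      (∫ z in Set.pi Set.univ (fun _ : Fin 2 => Set.Icc (0:ℝ) 1),
        (MvPolynomial.aeval (((1:ℝ)) • z) (MvPolynomial.pderiv (j i) (P i)) *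
              MvPolynomial.aeval (((1:ℝ)) • z) (Q i) -
            MvPolynomial.aeval (((1:ℝ)) • z) (P i) *
              MvPolynomial.aeval (((1:ℝ)) • z) (MvPolynomial.pderiv (j i) (Q i))) /
          (MvPolynomial.aeval (((1:ℝ)) • z) (Q i)) ^ 2) = 0) :
    ∃ (T : ℕ) (d : Fin T → ℕ) (G : (j : Fin T) → (Fin (d j) → ℝ) → ℝ)
      (V : (j : Fin T) → Set (Fin (d j) → ℝ)) (μ : Fin T → Polynomial ℝ) (μ₀ : Polynomial ℝ),
      (∀ j, IsOpen (V j) ∧ Set.pi Set.univ (fun _ : Fin (d j) => Set.Icc (0:ℝ) 1) ⊆ (V j) ∧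
        Literature.NumberTheory.Transcendental.IsSemialgebraicFunOn ℚ (V j) (G j) ∧
        AnalyticOnNhd ℝ (G j) (V j)) ∧
      (∀ j k, IsAlgebraic ℚ ((μ j).coeff k)) ∧ (∀ k, IsAlgebraic ℚ (μ₀.coeff k)) ∧
      ∀ ϖ ∈ Set.Icc (0:ℝ) 1, (m₀ : ℝ) + ∑ i, (m i : ℝ) *
          (∫ z in Set.pi Set.univ (fun _ : Fin 2 => Set.Icc (0:ℝ) 1),
            (MvPolynomial.aeval (ϖ • z) (MvPolynomial.pderiv (j i) (P i)) *
                  MvPolynomial.aeval (ϖ • z) (Q i) -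
                MvPolynomial.aeval (ϖ • z) (P i) *
                  MvPolynomial.aeval (ϖ • z) (MvPolynomial.pderiv (j i) (Q i))) /
              (MvPolynomial.aeval (ϖ • z) (Q i)) ^ 2) =
        (ϖ - 1) * (μ₀.eval ϖ + ∑ j, (μ j).eval ϖ *
          (∫ z in Set.pi Set.univ (fun _ : Fin (d j) => Set.Icc (0:ℝ) 1), G j (ϖ • z))) := by
  classical
  -- swapped potentials for the `x₁`-exact pieces
  set σ : Fin 2 ≃ Fin 2 := Equiv.swap (0 : Fin 2) 1 with hσ
  set P' : Fin S → MvPolynomial (Fin 2) ℚ := fun i =>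
    if j i = 0 then P i else MvPolynomial.rename σ (P i) with hP'
  set Q' : Fin S → MvPolynomial (Fin 2) ℚ := fun i =>
    if j i = 0 then Q i else MvPolynomial.rename σ (Q i) with hQ'
  have hbox : ∀ p ∈ Set.pi Set.univ (fun _ : Fin 2 => Set.Ioo (a:ℝ) b),
      p ∘ σ ∈ Set.pi Set.univ (fun _ : Fin 2 => Set.Ioo (a:ℝ) b) := by
    intro p hp
    rw [Set.mem_univ_pi] at hp ⊢
    exact fun i => hp (σ i)
  have hQ'' : ∀ i, ∀ p ∈ Set.pi Set.univ (fun _ : Fin 2 => Set.Ioo (a:ℝ) b),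
      MvPolynomial.aeval p (Q' i) ≠ 0 := by
    intro i p hp
    by_cases h0 : j i = 0
    · simp only [hQ', h0, if_true]
      exact hQ i p hp
    · simp only [hQ', h0, if_false, MvPolynomial.aeval_rename]
      exact hQ i _ (hbox p hp)
  -- the dilation functions agree
  have hfun : ∀ (i) (ϖ : ℝ), (∫ z in Set.pi Set.univ (fun _ : Fin 2 => Set.Icc (0:ℝ) 1),
      (MvPolynomial.aeval (ϖ • z) (MvPolynomial.pderiv (j i) (P i)) * MvPolynomial.aeval (ϖ • z) (Q i) -
          MvPolynomial.aeval (ϖ • z) (P i) * MvPolynomial.aeval (ϖ • z) (MvPolynomial.pderiv (j i) (Q i))) /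
        (MvPolynomial.aeval (ϖ • z) (Q i)) ^ 2) =
      ∫ z in Set.pi Set.univ (fun _ : Fin 2 => Set.Icc (0:ℝ) 1),
        (MvPolynomial.aeval (ϖ • z) (MvPolynomial.pderiv 0 (P' i)) * MvPolynomial.aeval (ϖ • z) (Q' i) -
            MvPolynomial.aeval (ϖ • z) (P' i) * MvPolynomial.aeval (ϖ • z) (MvPolynomial.pderiv 0 (Q' i))) /
          (MvPolynomial.aeval (ϖ • z) (Q' i)) ^ 2 := by
    intro i ϖ
    by_cases h0 : j i = 0
    · simp only [hP', hQ', h0, if_true]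
    · have h1 : j i = 1 := Fin.eq_one_of_ne_zero (j i) h0
      simp only [hP', hQ', h1]
      exact Literature.NumberTheory.Transcendental.KZ.StokesDescent.dilation_integral_pderiv_one_eq_swap
        (P i) (Q i) ϖ
  simp only [hfun] at hsum ⊢
  exact dilationLiftAtOne_dimTwoStokesRational S P' Q' a b ha hb hQ'' m m₀ hsum

end Summit.KontsevichZagierPeriods.LiftingCriteria.DilationLiftAtOne
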